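import Summits.MatrixMultiplication.MatrixMultiplication.Theorems.SoloInformedTwistedTPPSchemes
import Summits.MatrixMultiplication.MatrixMultiplication.Theorems.SoloInformedCyclotomicSchemes
import HarnessLib

/-!
# Cyclotomic schemes need rank `≥ c·n^{69/34}` to realize `⟨n,n,n⟩` (Corollary C′, kernel form)

Solo-informed seat (MatrixMultiplication), gen 104; dossier `paper/theoremB2.md` §7, Corollary C′.

Cohn–Umans 2013 (§5–6, Conj. 21) ask for commutative association schemes of rank `n^{2+o(1)}`
realizing `⟨n,n,n⟩` (Def. 12), and name the cyclotomic schemes `Cyc(q, H)` (`H ≤ 𝔽_qˣ` of index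
`r'`, rank `r' + 1`) as candidates. `cyclotomicScheme_rank_exponent`: for EVERY `q` and `H`, a
realization of `⟨n,n,n⟩` (`n ≥ 4`) by `Cyc(q,H)` forces `n^69 ≤ 115200 · 2^77 · r'^34`
(`r' = (q-1)/|H|`), i.e. rank `≥ 2^{-2.75}·n^{69/34} = c·n^{2.029…}` — so Conj. 21 fails on the whole
cyclotomic family. Proof = few classes never suffice (`Cyclotomic.cyclotomicScheme_realization_bound`,
character sums: `q ≤ 4r'^4/N`, `|H| ≤ 4r'^3/N` with `N ≥ n^6/32` the size of an explicit
matrix-multiplication-free triple) × few multipliers never suffice (Theorem C2,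
`TwistedTPP.cyclotomicScheme_realization_cube_le`: `n³ ≤ 115200 |H|^10 q`).
References: CohnUmans2013 (arXiv:1207.6528) §5, §6, Conj. 21; this work (Thm C1, Thm C2, Cor. C′).
-/

noncomputable section

open scoped BigOperators
open Finset

namespace Summit.MatrixMultiplication.MatrixMultiplication.Theorems.TwistedTPP

set_option maxHeartbeats 400000 in
/-- **Corollary C′ (kernel form).** If the cyclotomic scheme `Cyc(q, H)` realizes `⟨n,n,n⟩`, `n ≥ 4`,
then `n^69 ≤ 115200·2^77·((q-1)/|H|)^34`; the rank `(q-1)/|H| + 1` is `≥ 2^{-11/4}·n^{69/34}`.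
[this work, Cor. C′ of Thms C1 + C2] -/
theorem cyclotomicScheme_rank_exponent {F : Type*} [Field F] [Fintype F] [DecidableEq F]
    (H : Subgroup Fˣ) {Cl : Type*} (c : F → Cl) (hc : ∀ g h : F, c g = c h ↔ ∃ u ∈ H, (u : F) * g = h)
    {n : ℕ} (α β γ : Fin n × Fin n → Cl)
    (hreal : ∀ x y z : Fin n × Fin n,
      (∃ g h l : F, c g = α x ∧ c h = β y ∧ c l = γ z ∧ g + h + l = 0) ↔
        (y.1 = x.2 ∧ z = (y.2, x.1)))
    (hn : 4 ≤ n) :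
    (n : ℝ) ^ 69 ≤ 115200 * 2 ^ 77 * (((Fintype.card F : ℝ) - 1) / Nat.card H) ^ 34 := by
  classical
  haveI : Fintype H := Fintype.ofFinite _
  have hm1 : 1 ≤ Nat.card H := Nat.one_le_iff_ne_zero.2 Nat.card_pos.ne'
  -- Step 0: the representatives are injective, so `n² ≤ q`
  have w : Fin n := ⟨0, by omega⟩
  have hA : ∀ x, ∃ g : F, c g = α x := fun x => by
    obtain ⟨g, h, l, hg, -, -, -⟩ := (hreal x (x.2, w) (w, x.1)).2 ⟨rfl, rfl⟩
    exact ⟨g, hg⟩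
  choose a ha using hA
  have hainj : Function.Injective a := by
    intro x x' hxx
    obtain ⟨g, h, l, hg, hh, hl, hs⟩ := (hreal x (x.2, w) (w, x.1)).2 ⟨rfl, rfl⟩
    have hg' : c g = α x' := by rw [hg, ← ha x, hxx, ha x']
    obtain ⟨h1, h2⟩ := (hreal x' (x.2, w) (w, x.1)).1 ⟨g, h, l, hg', hh, hl, hs⟩
    simp only [Prod.mk.injEq, true_and] at h1 h2
    exact Prod.ext h2 h1
  have hnq : n * n ≤ Fintype.card F := by
    simpa [Fintype.card_prod, Fintype.card_fin] using Fintype.card_le_of_injective a hainj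
  -- Step 1 (Theorem C2)
  have hC2 := cyclotomicScheme_realization_cube_le H c hc α β γ hreal
  -- Step 2 (Theorem C1) on the free triple `[n] × [n/2)`, `[n/2, n) × [n]`, `[n]²`
  set h : ℕ := n / 2 with hh
  have h2h : n ≤ 2 * h + 1 := by omega
  have hh2 : 2 * h ≤ n := by omega
  have hhn : h ≤ n := by omega
  let T₁ : Finset (Fin n) := Finset.univ.image (Fin.castLE hhn)
  have hT₁ : T₁.card = h := by
    simp [T₁, Finset.card_image_of_injective _ (Fin.castLE_injective hhn)]
  let I : Finset (Fin n × Fin n) := Finset.univ ×ˢ T₁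
  let J : Finset (Fin n × Fin n) := T₁ᶜ ×ˢ Finset.univ
  let K : Finset (Fin n × Fin n) := Finset.univ
  have hIc : I.card = n * h := by simp [I, Finset.card_product, hT₁]
  have hJc : J.card = (n - h) * n := by simp [J, Finset.card_product, Finset.card_compl, hT₁]
  have hKc : K.card = n * n := by simp [K, Finset.card_univ, Fintype.card_prod]
  have hfree : ∀ x ∈ I, ∀ y ∈ J, ∀ z ∈ K, ¬ (y.1 = x.2 ∧ z = (y.2, x.1)) := by
    rintro x hx y hy z - ⟨h1, -⟩
    simp only [I, J, Finset.mem_product, Finset.mem_univ, true_and, and_true, Finset.mem_compl] at hx hy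
    exact hy (h1 ▸ hx)
  have hC1 := Cyclotomic.cyclotomicScheme_realization_bound H c hc α β γ hreal I J K hfree
  rw [hIc, hJc, hKc] at hC1
  clear hfree hIc hJc hKc hT₁ I J K T₁ hainj ha a w
  -- real-number bookkeeping
  set N : ℝ := ((n * h - 1 : ℕ) : ℝ) * (((n - h) * n - 1 : ℕ) : ℝ) * ((n * n - 1 : ℕ) : ℝ) with hN
  set qr : ℝ := (Fintype.card F : ℝ) with hqr
  set mr : ℝ := (Nat.card H : ℝ) with hmr
  have hn' : (4:ℝ) ≤ n := by exact_mod_cast hn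
  have hmr1 : (1:ℝ) ≤ mr := by rw [hmr]; exact_mod_cast hm1
  have hq16 : (16:ℝ) ≤ qr := by
    have : 16 ≤ Fintype.card F := le_trans (Nat.mul_le_mul hn hn) hnq
    rw [hqr]; exact_mod_cast this
  -- `N ≥ n⁶/32`
  have e1 : ((n * h - 1 : ℕ) : ℝ) = (n : ℝ) * h - 1 := by
    have : 1 ≤ n * h := by nlinarith
    push_cast [Nat.cast_sub this]; ring
  have e2 : (((n - h) * n - 1 : ℕ) : ℝ) = ((n : ℝ) - h) * n - 1 := by
    have h1 : 1 ≤ (n - h) * n := by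
      have : 1 ≤ n - h := by omega
      nlinarith
    push_cast [Nat.cast_sub h1, Nat.cast_sub hhn]; ring
  have e3 : ((n * n - 1 : ℕ) : ℝ) = (n : ℝ) * n - 1 := by
    have : 1 ≤ n * n := by nlinarith
    push_cast [Nat.cast_sub this]; ring
  have h2h' : (n : ℝ) ≤ 2 * h + 1 := by exact_mod_cast h2h
  have hh2' : 2 * (h : ℝ) ≤ n := by exact_mod_cast hh2
  have b1 : (n : ℝ) ^ 2 / 4 ≤ (n : ℝ) * h - 1 := by nlinarith
  have b2 : (n : ℝ) ^ 2 / 4 ≤ ((n : ℝ) - h) * n - 1 := by nlinarith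
  have b3 : (n : ℝ) ^ 2 / 2 ≤ (n : ℝ) * n - 1 := by nlinarith
  have p4 : (0 : ℝ) ≤ (n : ℝ) ^ 2 / 4 := by positivity
  have p2 : (0 : ℝ) ≤ (n : ℝ) ^ 2 / 2 := by positivity
  have hNlow : (n : ℝ) ^ 6 ≤ 32 * N := by
    have h12 : (n : ℝ) ^ 2 / 4 * ((n : ℝ) ^ 2 / 4) ≤ ((n : ℝ) * h - 1) * (((n : ℝ) - h) * n - 1) :=
      mul_le_mul b1 b2 p4 (p4.trans b1)
    have h123 : (n : ℝ) ^ 2 / 4 * ((n : ℝ) ^ 2 / 4) * ((n : ℝ) ^ 2 / 2)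
        ≤ ((n : ℝ) * h - 1) * (((n : ℝ) - h) * n - 1) * ((n : ℝ) * n - 1) :=
      mul_le_mul h12 b3 p2 ((mul_nonneg p4 p4).trans h12)
    calc (n : ℝ) ^ 6 = 32 * ((n : ℝ) ^ 2 / 4 * ((n : ℝ) ^ 2 / 4) * ((n : ℝ) ^ 2 / 2)) := by ring
      _ ≤ 32 * (((n : ℝ) * h - 1) * (((n : ℝ) - h) * n - 1) * ((n : ℝ) * n - 1)) := by linarith
      _ = 32 * N := by rw [hN, e1, e2, e3]
  have hNpos : 0 < N := by
    have : (0 : ℝ) < (n : ℝ) ^ 6 := by positivity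
    linarith
  have hqpos : 0 < qr := by linarith
  have hmpos : 0 < mr := by linarith
  -- `Q = q - 1 = mr · r`
  set Q : ℝ := qr - 1 with hQ
  have hQpos : 0 < Q := by rw [hQ]; linarith
  set r : ℝ := Q / mr with hr
  have hQmr : Q = mr * r := by rw [hr]; field_simp
  have hrpos : 0 < r := by rw [hr]; positivity
  -- C1 ⟹ `q · N · m⁴ ≤ 4 Q⁴`
  have hC1' : (qr - 2) ^ 2 * N * mr ^ 4 ≤ qr * Q ^ 4 := hC1
  have hq4 : qr ^ 2 / 4 ≤ (qr - 2) ^ 2 := by nlinarith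
  have hNm : 0 ≤ N * mr ^ 4 := by positivity
  have key : qr * N * mr ^ 4 ≤ 4 * Q ^ 4 := by
    have h3 : qr ^ 2 / 4 * (N * mr ^ 4) ≤ (qr - 2) ^ 2 * (N * mr ^ 4) :=
      mul_le_mul_of_nonneg_right hq4 hNm
    have eq1 : qr * (qr * N * mr ^ 4) = 4 * (qr ^ 2 / 4 * (N * mr ^ 4)) := by ring
    have eq2 : (qr - 2) ^ 2 * (N * mr ^ 4) = (qr - 2) ^ 2 * N * mr ^ 4 := by ring
    have eq3 : qr * (4 * Q ^ 4) = 4 * (qr * Q ^ 4) := by ring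
    have h4 : qr * (qr * N * mr ^ 4) ≤ qr * (4 * Q ^ 4) := by
      rw [eq1, eq3]; rw [eq2] at h3; linarith
    exact le_of_mul_le_mul_left h4 hqpos
  -- (i) `q N ≤ 4 r⁴`
  have hi : qr * N ≤ 4 * r ^ 4 := by
    have h5 : mr ^ 4 * (qr * N) ≤ mr ^ 4 * (4 * r ^ 4) := by
      calc mr ^ 4 * (qr * N) = qr * N * mr ^ 4 := by ring
        _ ≤ 4 * Q ^ 4 := key
        _ = mr ^ 4 * (4 * r ^ 4) := by rw [hQmr]; ring
    exact le_of_mul_le_mul_left h5 (by positivity)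
  -- (ii) `N m ≤ 4 r³`
  have hii : N * mr ≤ 4 * r ^ 3 := by
    have h6 : Q * N * mr ^ 4 ≤ qr * N * mr ^ 4 := by
      have : Q ≤ qr := by rw [hQ]; linarith
      exact mul_le_mul_of_nonneg_right (mul_le_mul_of_nonneg_right this hNpos.le) (by positivity)
    have eq4 : Q * (N * mr ^ 4) = Q * N * mr ^ 4 := by ring
    have eq5 : Q * (4 * Q ^ 3) = 4 * Q ^ 4 := by ring
    have h7 : Q * (N * mr ^ 4) ≤ Q * (4 * Q ^ 3) := by rw [eq4, eq5]; exact h6.trans key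
    have h8 : N * mr ^ 4 ≤ 4 * Q ^ 3 := le_of_mul_le_mul_left h7 hQpos
    have h9 : mr ^ 3 * (N * mr) ≤ mr ^ 3 * (4 * r ^ 3) := by
      calc mr ^ 3 * (N * mr) = N * mr ^ 4 := by ring
        _ ≤ 4 * Q ^ 3 := h8
        _ = mr ^ 3 * (4 * r ^ 3) := by rw [hQmr]; ring
    exact le_of_mul_le_mul_left h9 (by positivity)
  -- (iii) C2: `n³ ≤ 115200 m¹⁰ q`, hence `n³ N¹¹ ≤ 115200 · 4¹¹ · r³⁴`
  have hC2' : (n : ℝ) ^ 3 ≤ 115200 * mr ^ 10 * qr := by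
    rw [hmr, hqr]; exact_mod_cast hC2
  have hiii : (n : ℝ) ^ 3 * N ^ 11 ≤ 115200 * 4 ^ 11 * r ^ 34 := by
    have hNmr : 0 ≤ N * mr := by positivity
    have hp10 : (N * mr) ^ 10 ≤ (4 * r ^ 3) ^ 10 := pow_le_pow_left₀ hNmr hii 10
    have hprod : (N * mr) ^ 10 * (qr * N) ≤ (4 * r ^ 3) ^ 10 * (4 * r ^ 4) :=
      mul_le_mul hp10 hi (by positivity) (by positivity)
    calc (n : ℝ) ^ 3 * N ^ 11 ≤ 115200 * mr ^ 10 * qr * N ^ 11 :=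
          mul_le_mul_of_nonneg_right hC2' (by positivity)
      _ = 115200 * ((N * mr) ^ 10 * (qr * N)) := by ring
      _ ≤ 115200 * ((4 * r ^ 3) ^ 10 * (4 * r ^ 4)) := by gcongr
      _ = 115200 * 4 ^ 11 * r ^ 34 := by ring
  -- (iv) assemble with `n⁶ ≤ 32 N`
  have hn6 : 0 ≤ (n : ℝ) ^ 6 := by positivity
  have hp11 : ((n : ℝ) ^ 6) ^ 11 ≤ (32 * N) ^ 11 := pow_le_pow_left₀ hn6 hNlow 11
  calc (n : ℝ) ^ 69 = (n : ℝ) ^ 3 * ((n : ℝ) ^ 6) ^ 11 := by ring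
    _ ≤ (n : ℝ) ^ 3 * (32 * N) ^ 11 := mul_le_mul_of_nonneg_left hp11 (by positivity)
    _ = 32 ^ 11 * ((n : ℝ) ^ 3 * N ^ 11) := by ring
    _ ≤ 32 ^ 11 * (115200 * 4 ^ 11 * r ^ 34) := by gcongr
    _ = 115200 * 2 ^ 77 * r ^ 34 := by ring

end Summit.MatrixMultiplication.MatrixMultiplication.Theorems.TwistedTPP
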